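import Summits.Langlands.Langlands.Theses.NonParallelVoid

/-!
# `TwistedInductionParallel` (crux stmt-Langlands-17000, route `NonParallelVoid`): the ARITHMETIC of the
# lever — what `SameParity` and non-parallelness buy, and the kernel of the F-level twist obstruction
# (negative-side support, refuter cdisprove seat; tightness / small-model lemmas, sorry-free)

The route's lever (line `symmetrise-pd-split`) twists `ρ|Γ_E` by a Hodge–Tate character `χ` so that
`det(ρ|_E ⊗ χ) = θ|_E` descends to a totally real `K`, and feeds `I = Ind_E^K(ρ|_E ⊗ χ)` to
Barnet-Lamb–Gee–Geraghty–Taylor Thm. C, which needs `I` Hodge–Tate REGULAR.  On labelled weights, at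
the places `w ∣ v`, `w' ∣ v̄` of `E` over one place `u` of `K` (weights `{a, b}`, `{a', b'}` of `ρ`,
`k, l` of `χ`, `t` of `θ`), descent says `(a+b) + 2k = t = (a'+b') + 2l` and regularity says the four
induced weights `{a+k, b+k, a'+l, b'+l}` are distinct.  Kernel-checked:

* `exists_concentric_shift_iff` — such `k, l` exist iff the gap sum `(b−a)+(b'−a')` is even: the crux
  hypothesis `SameParity` is NECESSARY AND SUFFICIENT for the symmetrising step (the odd sector is the
  sibling cruxes `TensorSquareParallel`/`EmptyWeightCore`, not a strengthening of this one).
* `concentric_nodup_iff_ne` — given descent, the induced weights are distinct iff the gaps DIFFER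
  (the "parity–regularity coincidence" of the route header as an identity); `concentric_pairs_eq_of_parallel`
  — PARALLEL gaps make the two pairs coincide: the `NonRegularWeightBarrier` in numbers (why the lever
  can only ever run by contraposition from a non-parallel pair).
* `no_symmetrising_pair_of_two_torsion` — in abelian groups, `ψ = (θ ∘ N)·χ²` forces `ψ = 1` on every
  `2`-torsion element of `ker N`; with `G = G_F^ab`, `N` the transfer to `G_ℚ^ab`, `ψ = det ρ` and
  `t = s_v·s_v̄` (local `−1`'s at the two places over a split `ℓ ≡ 3 (mod 4)`, `det ρ|I_v` the quadratic
  character, `det ρ|I_v̄` even) this is the obstruction to the route HEADER's twist over `F` itself —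
  the reason stub 1 symmetrises over a REAL QUADRATIC `K` instead; `quadraticChar_ne_sq` is its local
  shadow (the quadratic character of `𝔽_ℓ`, `ℓ ≡ 3 (4)`, is not a square: evaluate at `−1`).

This file does NOT refute the crux; it certifies which hypotheses the lever consumes and why.
-/

-- `Summit.Langlands.Langlands.…` repeats a namespace component by design (D-0017 nested layout).
set_option linter.dupNamespace false

namespace Summit.Langlands.Langlands.Theorems.TwistedInductionParallel.Negative

/-- **`SameParity` ⇔ a symmetrising shift exists**: integers `k, l` with `(a+b)+2k = (a'+b')+2l` exist
iff `(b−a)+(b'−a')` is even. [folklore] -/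
theorem exists_concentric_shift_iff (a b a' b' : ℤ) :
    (∃ k l : ℤ, a + b + 2 * k = a' + b' + 2 * l) ↔ Even (b - a + (b' - a')) := by
  simp only [Int.even_iff]
  constructor
  · rintro ⟨k, l, h⟩
    omega
  · intro h
    exact ⟨(a' + b' - (a + b)) / 2, 0, by omega⟩

/-- **Regular iff non-parallel** (given the descended determinant): for `a < b`, `a' < b'` and
`(a+b)+2k = (a'+b')+2l` the induced weights `{a+k, b+k, a'+l, b'+l}` are pairwise distinct iff the gaps
differ (Barnet-Lamb–Gee–Geraghty–Taylor Thm. C asks `n` distinct `τ`-Hodge–Tate numbers). [folklore] -/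
theorem concentric_nodup_iff_ne (a b a' b' k l : ℤ) (hab : a < b) (hab' : a' < b')
    (hdet : a + b + 2 * k = a' + b' + 2 * l) :
    ({a + k, b + k, a' + l, b' + l} : Multiset ℤ).Nodup ↔ b - a ≠ b' - a' := by
  simp only [Multiset.insert_eq_cons, Multiset.nodup_cons, Multiset.mem_cons,
    Multiset.mem_singleton, Multiset.nodup_singleton, and_true, not_or]
  omega

/-- **Parallel ⇒ maximally irregular**: with equal gaps the two concentric pairs coincide
(the `NonRegularWeightBarrier` as an identity). [folklore] -/
theorem concentric_pairs_eq_of_parallel (a b a' b' k l : ℤ)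
    (hdet : a + b + 2 * k = a' + b' + 2 * l) (hgap : b - a = b' - a') :
    a + k = a' + l ∧ b + k = b' + l := by
  omega

/-- **Kernel of the F-level twist obstruction.**  In abelian groups: if `ψ = (θ ∘ N) · χ²` then `ψ`
is trivial on every `2`-torsion element `t` of `ker N` (`χ(t)² = χ(t²) = 1`).  Hence a `ψ` with
`ψ(t) ≠ 1` for such a `t` is NOT of that form for any `θ, χ`. [folklore] -/
theorem no_symmetrising_pair_of_two_torsion {G G' C : Type*} [CommGroup G] [CommGroup G']
    [CommGroup C] (N : G →* G') (ψ : G →* C) {t : G} (ht : t * t = 1) (hN : N t = 1)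
    (hψ : ψ t ≠ 1) : ¬ ∃ (θ : G' →* C) (χ : G →* C), ∀ g, ψ g = θ (N g) * χ g ^ 2 := by
  rintro ⟨θ, χ, h⟩
  apply hψ
  rw [h t, hN, map_one, one_mul, sq, ← map_mul, ht, map_one]

/-- The quadratic character of `𝔽_ℓ`, `ℓ ≡ 3 (mod 4)`, is `−1` at `−1`
(Mathlib `quadraticChar_neg_one`, `ZMod.χ₄_nat_three_mod_four`). [folklore] -/
theorem quadraticChar_neg_one_of_mod_four {ℓ : ℕ} [Fact ℓ.Prime] (hℓ : ℓ % 4 = 3) :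
    quadraticChar (ZMod ℓ) (-1) = -1 := by
  have h2 : ringChar (ZMod ℓ) ≠ 2 := by
    rw [ZMod.ringChar_zmod_n]
    omega
  rw [quadraticChar_neg_one h2, ZMod.card ℓ]
  exact ZMod.χ₄_nat_three_mod_four hℓ

/-- **The quadratic character of `𝔽_ℓ` (`ℓ ≡ 3 mod 4`) is not a square in the character group**: a
square is `χ(−1)² = χ(1) = 1` at `−1`.  (Local shadow of the obstruction: the inertial restriction of
`det ρ` at a split `ℓ ≡ 3 (4)` may be this character at `v` and even at `v̄`, and then no twist
`det ρ · χ²` is `Gal(F/ℚ)`-invariant.) [folklore] -/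
theorem quadraticChar_ne_sq {ℓ : ℕ} [Fact ℓ.Prime] (hℓ : ℓ % 4 = 3) (χ : MulChar (ZMod ℓ) ℤ) :
    χ * χ ≠ quadraticChar (ZMod ℓ) := by
  intro h
  have h1 : (χ * χ) (-1) = 1 := by
    rw [MulChar.mul_apply, ← map_mul, neg_mul_neg, one_mul, map_one]
  rw [h, quadraticChar_neg_one_of_mod_four hℓ] at h1
  exact absurd h1 (by decide)

end Summit.Langlands.Langlands.Theorems.TwistedInductionParallel.Negative
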